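import Summits.QuantumFields.BalabanUV.T4Continuum.Support.NE9MajorantLipschitzSharp
import Summits.QuantumFields.BalabanUV.T4Continuum.Support.NE9BridgeSizeInduction

/-!
# NE9VacuumSubtractedBridgeFloor — END #1 (`NE9VacuumSubtractedBridge` ∕ `NE9BridgeSizeInduction` §3) RE-THREADED at the two-point constant 1 of
# `NE9MajorantLipschitzSharp`: (L) at `2·clip·B₀ + 2·lip·B₀·qT` (was `8·… + 8·…`), `OutputLipschitz` at `2·lip·B₀` (was `8·lip·B₀`), the END at
# `ℓ = 2·clipbar·B + 2·lipbar·B·qTbar`, rate `ω + 2·lipbar·B·τ̄` (was `8·…`), and its occupation-DERIVED form — SAME binders as END #1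

Cell `pub-balaban`, T4-DAG §6 row NE9; NE9 crux team (coordinator ruling «YM REDIRECT» e34b3e0c (2)), leaf lineage
`b2b-balaban-t4-ne9-formalise-leaf-06` generation 39; routes R3′∕R4 (END #1's architecture and the SHARED coupling half D2); journal INTENT 5.
The sibling `NE9MajorantLipschitzSharp` removes the factor 4 from the tree's two-configuration cluster-sum bound under a common majorant (segment mean
value at the convex interpolation points, KP for `2m` unchanged) and hence from END #1's two lemmas `norm_newTerm_sub_le_of_twoPointKP` ∕
`norm_newTerm_sub_le_of_couplingTwoPoint`; THIS FILE threads those through END #1's vacuum-subtracted bridge VERBATIM (proof texts of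
`NE9VacuumSubtractedBridge` §1–§3 and `NE9BridgeSizeInduction` §3 with the two lemma names swapped and every `4·`∕`8·` halved twice).  With the
sibling `NE9TwoPointKPOfPencilSharp` (p256978, `lipbar = 1/(R₀ − s₀)`) the rate is the record floor `ω + 2·B·τ̄/(R₀ − s₀)` (refuter PRICING-NE9 v8∕v9
`c_eff = 2`) INSIDE END #1's own `TwoPointKP` architecture, and the coupling part of the moduli constant `ℓ` drops `8·clipbar·B ↦ 2·clipbar·B` for both
co-leads (D2 is shared).

HONEST FRAMING (T4-DAG PAGE 1).  Rung (B)+1 of the FINITE-VOLUME T⁴ programme — NOT infinite volume, NOT a mass gap, NOT the Clay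
problem.  NE9 (`T4OutputRate.NE9` ∧ `FadingMemory`) is a cell NEW ESTIMATE, NOT PRINTED in [I] = [Balaban1987RG1] (CMP **109**), [II] =
[Balaban1988RG2Cluster] (CMP **116**), and NOT PROVED for Bałaban's E^{(j)} («NE9 ⇐ the named binders»; row WALLED ON A MODEL O-NE9-1; spine
PROVED 0∕9); a sharper constant in a CONDITIONAL END is not progress on the estimate itself.  HONEST DEPENDENCY (cell line, verbatim):
continuum YM on T⁴ ⇐ BetaPertH ∧ nine spine estimates (0/9 proved); BetaPertH ⇐ (D1) ∧ (D4) ∧ CAP+tail; G-an2-4 gates asym, D1 and NE2/3/4.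
`FlowStep.BetaPertH`, (B), (B^μ) do not occur.  Bookkeeping over ABSTRACT carriers; no `def`, no Prop-valued definition, no estimate of any object of the
series; [I]∕[II] for TYPES only (ABSOLUTE RULE).  0 sorry.

* §1 [folklore] `outputLipschitz_of_twoPointKP_vacSub_sharp` (`fun k ↦ 2·lip k·B₀ k`), `lastCouplingLipschitz_of_couplingTwoPoint_vacSub_sharp1`
  (`fun k ↦ 2·clip k·B₀ k + 2·lip k·B₀ k·qT k`), **`ne9_and_fadingMemory_of_couplingTwoPoint_vacSub_sharp1`** (END #1's binder list VERBATIM, `hpos`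
  re-lettered ⊢ `ℓ = 2·clipbar·B + 2·lipbar·B·qTbar`, rate `ω + 2·lipbar·B·τ̄`), **`…_vacSub_sizeInduction_sharp1`** (occupation DERIVED by
  `NE9BridgeSizeInduction.termSize_of_recursion_vacSub` BY NAME; + `TermSize`).
* §2 [folklore] **`lastCouplingLipschitz_of_couplingTwoPoint_vacSub_sharp2`** — p256991 §1's binders VERBATIM ⊢ `LastCouplingLipschitz … (fun k ↦ 2·clip k·B₀ k +
  2·B₀ k/(R₀ − s₀)·qT k)` (p256991 §1 has `8·clip`; the owner's E131 `NE9HoloFamilyCoupledEnd` §3 consumes p256991 §1 — its ℓ coupling part `÷ 4` by one name swap).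
DISGUISE TEST: END #1's bookkeeping at smaller constants; not NE9.  WHAT THIS DOES NOT DO: touches no activity, no species, no estimate of Bałaban's;
`TwoPointKP` (KP for `2n`), `hCup`, `hTcup`, decay, pin budget, reading, `hreprV`, size data stay DISPLAYED; the model O-NE9-1 and the display `z` untouched.

References (TYPES only): [Balaban1987RG1] CMP **109** (1987) — (1.18) p. 263, (2.12)–(2.14) p. 268; [Balaban1988RG2Cluster] CMP **116** (1988) — (1.36) p. 9,
(2.13)–(2.15) pp. 14–15, Lemma 3 (2.38) p. 20, (2.40)–(2.41) p. 21; [KoteckyPreiss1986] CMP **103** (1986).  Summits-side NEW work (LEAN PLACEMENT RULE);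
imports `NE9MajorantLipschitzSharp` (this lineage) and `NE9BridgeSizeInduction` (owner lineage) BY NAME; modifies nothing; 0 sorry.  Value = END #1's
constants `8 ↦ 2` in both (L) and the rate with NO new displayed input, NOT summit progress.
-/

noncomputable section

namespace Summit.QuantumFields.BalabanUV.T4Continuum.NE9VacuumSubtractedBridgeFloor

open scoped BigOperators ENNReal
open Metric Set
open Literature.Probability.LatticeModels
open Literature.MathematicalPhysics.QuantumFieldTheory.Balaban1983to89
open Literature.MathematicalPhysics.QuantumFieldTheory.Balaban1983to89.T4OutputRate
open Literature.MathematicalPhysics.QuantumFieldTheory.Balaban1983to89.T4ActivityLipschitz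
open Literature.MathematicalPhysics.QuantumFieldTheory.Balaban1983to89.T4HistoryLipschitzRecursion
open Literature.MathematicalPhysics.QuantumFieldTheory.Balaban1983to89.T4HistoryLipschitzOuter
open Literature.MathematicalPhysics.QuantumFieldTheory.Balaban1983to89.T4HistoryLipschitzActivity
open Literature.MathematicalPhysics.QuantumFieldTheory.Balaban1983to89.T4HistoryLipschitzActivity (ClusterGeom)
open Literature.MathematicalPhysics.QuantumFieldTheory.Balaban1983to89.T4HistoryLipschitzSegment
open Summit.QuantumFields.BalabanUV.T4Continuum.NE9LastCouplingBridge
open Summit.QuantumFields.BalabanUV.T4Continuum.NE9VacuumSubtractedBridge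
open Summit.QuantumFields.BalabanUV.T4Continuum.NE9BridgeSizeInduction
open Summit.QuantumFields.BalabanUV.T4Continuum.NE9PencilEndSharp
open Summit.QuantumFields.BalabanUV.T4Continuum.NE9MajorantLipschitzSharp

/-! ## §1 END #1 re-threaded at constant 1: (L) `2·clip·B₀ + 2·lip·B₀·qT`, output `2·lip·B₀`, rate `ω + 2·lipbar·B·τ̄` -/

section End

variable {C : Carriers} (G : ClusterGeom C) {Bg : Type} {Pot : Type*} [NormedAddCommGroup Pot]

/-- [folklore] **`OutputLipschitz` WITH THE VACUUM SUBTRACTION AT `2·lip k·B₀ k`** — `NE9VacuumSubtractedBridge.outputLipschitz_of_twoPointKP_vacSub`'s binders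
VERBATIM (its constant is `8·lip k·B₀ k`); §2's table two-point bound at `U` and at `U₀`, added. -/
theorem outputLipschitz_of_twoPointKP_vacSub_sharp {ι : Type} {E : Functional C Bg} {W : Set (ℕ → ℝ)}
    {T : ℕ → (ℕ → ℝ) → (Bg → C.Dom → ℝ) → ι → ℝ} {Ψ : ℕ → ℝ → (ι → ℝ) → Bg → C.Dom → ℝ}
    {act : ℕ → ℝ → Bg → Pot → G.P → ℂ} {𝒜 : ℕ → Set Pot} {n : ℕ → ℝ → Bg → G.P → ℝ} {lip : ℕ → ℝ}
    {a d : G.P → ℝ} {δ : C.Dom → ℝ} {B₀ : ℕ → ℝ} {κ : ℝ} {wt : ℕ → ι → ℝ} (ρ : ℕ → (ι → ℝ) → Pot) (U₀ : Bg)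
    (explZ : ℕ → Bg → C.Dom → ℝ) (hK : TwoPointKP G W act 𝒜 n lip a d) (hdec : G.DecayExtract δ d)
    (hpin : G.PinBudget a δ B₀ κ)
    (hρ : ∀ (k : ℕ) (P P' : ι → ℝ) (M : ℝ), (∀ y, |P y - P' y| ≤ wt k y * M) → ‖ρ k P - ρ k P'‖ ≤ M)
    (hreprV : ∀ (k : ℕ) (s : ℝ) (P : ι → ℝ) (U : Bg) (X : C.Dom),
      Ψ k s P U X = (G.newTerm act k s U X (ρ k P)).re - (G.newTerm act k s U₀ X (ρ k P)).re + explZ k U X)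
    (hocc : ∀ g ∈ W, ∀ g' ∈ W, ∀ k : ℕ, ρ k (T k g' (E g)) ∈ 𝒜 k) :
    OutputLipschitz E W T Ψ κ wt (fun k => 2 * lip k * B₀ k) := by
  intro g hg g' hg' k M hM U X hX
  set Q := ρ k (T k g' (E g))
  set Q' := ρ k (T k g' (E g'))
  have hQQ' : ‖Q - Q'‖ ≤ M := hρ k _ _ M hM
  have hQ : Q ∈ 𝒜 k := hocc g hg g' hg' k
  have hQ' : Q' ∈ 𝒜 k := hocc g' hg' g' hg' k
  have ha0 : 0 ≤ a (G.pin X) := hK.1 _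
  have hlip0 : 0 ≤ lip k := hK.2.2.1 k
  have henv := hpin k X hX
  have bound : ∀ V : Bg, ‖G.newTerm act k (g' k) V X Q - G.newTerm act k (g' k) V X Q'‖ ≤
      Real.exp (-(κ * C.d X)) * (lip k * B₀ k * M) := by
    intro V
    have key := norm_newTerm_sub_le_of_twoPointKP_sharp G hK hdec hg' hX (U := V) hQ hQ'
    calc ‖G.newTerm act k (g' k) V X Q - G.newTerm act k (g' k) V X Q'‖
        ≤ (lip k * ‖Q - Q'‖) * a (G.pin X) * Real.exp (-(δ X)) := key
      _ = lip k * ‖Q - Q'‖ * (a (G.pin X) * Real.exp (-(δ X))) := by ring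
      _ ≤ lip k * M * (B₀ k * Real.exp (-(κ * C.d X))) :=
          mul_le_mul (mul_le_mul_of_nonneg_left hQQ' hlip0) henv (mul_nonneg ha0 (Real.exp_nonneg _))
            (by have := (norm_nonneg _).trans hQQ'; positivity)
      _ = Real.exp (-(κ * C.d X)) * (lip k * B₀ k * M) := by ring
  rw [hreprV, hreprV]
  calc |(G.newTerm act k (g' k) U X Q).re - (G.newTerm act k (g' k) U₀ X Q).re + explZ k U X -
          ((G.newTerm act k (g' k) U X Q').re - (G.newTerm act k (g' k) U₀ X Q').re + explZ k U X)|
      = |(G.newTerm act k (g' k) U X Q - G.newTerm act k (g' k) U X Q').re -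
          (G.newTerm act k (g' k) U₀ X Q - G.newTerm act k (g' k) U₀ X Q').re| := by
        rw [Complex.sub_re, Complex.sub_re]; ring_nf
    _ ≤ ‖G.newTerm act k (g' k) U X Q - G.newTerm act k (g' k) U X Q'‖ +
          ‖G.newTerm act k (g' k) U₀ X Q - G.newTerm act k (g' k) U₀ X Q'‖ := abs_re_sub_re_le _ _
    _ ≤ Real.exp (-(κ * C.d X)) * (lip k * B₀ k * M) + Real.exp (-(κ * C.d X)) * (lip k * B₀ k * M) :=
        add_le_add (bound U) (bound U₀)
    _ = Real.exp (-(κ * C.d X)) * (2 * lip k * B₀ k * M) := by ring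

/-- [folklore] **`LastCouplingLipschitz` WITH THE VACUUM SUBTRACTION AT `2·clip k·B₀ k + 2·lip k·B₀ k·qT k`** —
`NE9VacuumSubtractedBridge.lastCouplingLipschitz_of_couplingTwoPoint_vacSub`'s binders VERBATIM (its constant is `8·… + 8·…`); §2's two bounds at `U` and `U₀`. -/
theorem lastCouplingLipschitz_of_couplingTwoPoint_vacSub_sharp1 {ι : Type} {E : Functional C Bg} {W : Set (ℕ → ℝ)}
    {T : ℕ → (ℕ → ℝ) → (Bg → C.Dom → ℝ) → ι → ℝ} {Ψ : ℕ → ℝ → (ι → ℝ) → Bg → C.Dom → ℝ}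
    {act : ℕ → ℝ → Bg → Pot → G.P → ℂ} {𝒜 : ℕ → Set Pot} {n : ℕ → ℝ → Bg → G.P → ℝ} {lip clip : ℕ → ℝ}
    {a d : G.P → ℝ} {δ : C.Dom → ℝ} {B₀ qT : ℕ → ℝ} {κ : ℝ} {wt : ℕ → ι → ℝ} (ρ : ℕ → (ι → ℝ) → Pot) (U₀ : Bg)
    (explZ : ℕ → Bg → C.Dom → ℝ) (hK : TwoPointKP G W act 𝒜 n lip a d) (hclip0 : ∀ k, 0 ≤ clip k)
    (hCup : ∀ g ∈ W, ∀ g' ∈ W, ∀ (k : ℕ) (U : Bg) (X : C.Dom), C.scale X = k + 1 → ∀ Q ∈ 𝒜 k, ∀ γ ∈ G.vol X,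
      ‖act k (g k) U Q γ‖ ≤ n k (g' k) U γ ∧
        ‖act k (g k) U Q γ - act k (g' k) U Q γ‖ ≤ clip k * |g k - g' k| * n k (g' k) U γ)
    (hdec : G.DecayExtract δ d) (hpin : G.PinBudget a δ B₀ κ)
    (hρ : ∀ (k : ℕ) (P P' : ι → ℝ) (M : ℝ), (∀ y, |P y - P' y| ≤ wt k y * M) → ‖ρ k P - ρ k P'‖ ≤ M)
    (hreprV : ∀ (k : ℕ) (s : ℝ) (P : ι → ℝ) (U : Bg) (X : C.Dom),
      Ψ k s P U X = (G.newTerm act k s U X (ρ k P)).re - (G.newTerm act k s U₀ X (ρ k P)).re + explZ k U X)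
    (hqT0 : ∀ k, 0 ≤ qT k)
    (hTcup : ∀ g ∈ W, ∀ g' ∈ W, ∀ (k : ℕ) (y : ι), |T k g (E g) y - T k g' (E g) y| ≤ wt k y * (qT k * |g k - g' k|))
    (hocc : ∀ g ∈ W, ∀ g' ∈ W, ∀ k : ℕ, ρ k (T k g' (E g)) ∈ 𝒜 k) :
    LastCouplingLipschitz E W T Ψ κ (fun k => 2 * clip k * B₀ k + 2 * lip k * B₀ k * qT k) := by
  intro g hg g' hg' k U X hX
  set P : ι → ℝ := T k g (E g)
  set P' : ι → ℝ := T k g' (E g)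
  have hQ : ρ k P ∈ 𝒜 k := hocc g hg g hg k
  have hQ' : ρ k P' ∈ 𝒜 k := hocc g hg g' hg' k
  have ha0 : 0 ≤ a (G.pin X) := hK.1 _
  have hlip0 : 0 ≤ lip k := hK.2.2.1 k
  have hclip0k : 0 ≤ clip k := hclip0 k
  have hqT0k : 0 ≤ qT k := hqT0 k
  have henv := hpin k X hX
  have hΔ : 0 ≤ |g k - g' k| := abs_nonneg _
  have h1 : ∀ V : Bg, ‖G.newTerm act k (g k) V X (ρ k P) - G.newTerm act k (g' k) V X (ρ k P)‖ ≤
      Real.exp (-(κ * C.d X)) * (clip k * B₀ k * |g k - g' k|) := by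
    intro V
    have hnt := norm_newTerm_sub_le_of_couplingTwoPoint_sharp G hK hclip0 hCup hdec hg hg' hX (U := V) hQ
    calc ‖G.newTerm act k (g k) V X (ρ k P) - G.newTerm act k (g' k) V X (ρ k P)‖
        ≤ (clip k * |g k - g' k|) * a (G.pin X) * Real.exp (-(δ X)) := hnt
      _ = clip k * |g k - g' k| * (a (G.pin X) * Real.exp (-(δ X))) := by ring
      _ ≤ clip k * |g k - g' k| * (B₀ k * Real.exp (-(κ * C.d X))) :=
          mul_le_mul_of_nonneg_left henv (by positivity)
      _ = Real.exp (-(κ * C.d X)) * (clip k * B₀ k * |g k - g' k|) := by ring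
  have hdist : ‖ρ k P - ρ k P'‖ ≤ qT k * |g k - g' k| :=
    hρ k P P' (qT k * |g k - g' k|) fun y => hTcup g hg g' hg' k y
  have h2 : ∀ V : Bg, ‖G.newTerm act k (g' k) V X (ρ k P) - G.newTerm act k (g' k) V X (ρ k P')‖ ≤
      Real.exp (-(κ * C.d X)) * (lip k * B₀ k * qT k * |g k - g' k|) := by
    intro V
    have hnt := norm_newTerm_sub_le_of_twoPointKP_sharp G hK hdec hg' hX (U := V) hQ hQ'
    calc ‖G.newTerm act k (g' k) V X (ρ k P) - G.newTerm act k (g' k) V X (ρ k P')‖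
        ≤ (lip k * ‖ρ k P - ρ k P'‖) * a (G.pin X) * Real.exp (-(δ X)) := hnt
      _ = lip k * ‖ρ k P - ρ k P'‖ * (a (G.pin X) * Real.exp (-(δ X))) := by ring
      _ ≤ lip k * (qT k * |g k - g' k|) * (B₀ k * Real.exp (-(κ * C.d X))) :=
          mul_le_mul (mul_le_mul_of_nonneg_left hdist hlip0) henv (mul_nonneg ha0 (Real.exp_nonneg _)) (by positivity)
      _ = Real.exp (-(κ * C.d X)) * (lip k * B₀ k * qT k * |g k - g' k|) := by ring
  have h3 : ∀ V : Bg, ‖G.newTerm act k (g k) V X (ρ k P) - G.newTerm act k (g' k) V X (ρ k P')‖ ≤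
      Real.exp (-(κ * C.d X)) * ((clip k * B₀ k + lip k * B₀ k * qT k) * |g k - g' k|) := by
    intro V
    calc ‖G.newTerm act k (g k) V X (ρ k P) - G.newTerm act k (g' k) V X (ρ k P')‖
        ≤ ‖G.newTerm act k (g k) V X (ρ k P) - G.newTerm act k (g' k) V X (ρ k P)‖ +
            ‖G.newTerm act k (g' k) V X (ρ k P) - G.newTerm act k (g' k) V X (ρ k P')‖ := norm_sub_le_norm_sub_add_norm_sub _ _ _
      _ ≤ Real.exp (-(κ * C.d X)) * (clip k * B₀ k * |g k - g' k|) +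
            Real.exp (-(κ * C.d X)) * (lip k * B₀ k * qT k * |g k - g' k|) := add_le_add (h1 V) (h2 V)
      _ = Real.exp (-(κ * C.d X)) * ((clip k * B₀ k + lip k * B₀ k * qT k) * |g k - g' k|) := by ring
  rw [hreprV k (g k) P U X, hreprV k (g' k) P' U X]
  calc |(G.newTerm act k (g k) U X (ρ k P)).re - (G.newTerm act k (g k) U₀ X (ρ k P)).re + explZ k U X -
          ((G.newTerm act k (g' k) U X (ρ k P')).re - (G.newTerm act k (g' k) U₀ X (ρ k P')).re + explZ k U X)|
      = |(G.newTerm act k (g k) U X (ρ k P) - G.newTerm act k (g' k) U X (ρ k P')).re -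
          (G.newTerm act k (g k) U₀ X (ρ k P) - G.newTerm act k (g' k) U₀ X (ρ k P')).re| := by
        rw [Complex.sub_re, Complex.sub_re]; ring_nf
    _ ≤ ‖G.newTerm act k (g k) U X (ρ k P) - G.newTerm act k (g' k) U X (ρ k P')‖ +
          ‖G.newTerm act k (g k) U₀ X (ρ k P) - G.newTerm act k (g' k) U₀ X (ρ k P')‖ := abs_re_sub_re_le _ _
    _ ≤ Real.exp (-(κ * C.d X)) * ((clip k * B₀ k + lip k * B₀ k * qT k) * |g k - g' k|) +
          Real.exp (-(κ * C.d X)) * ((clip k * B₀ k + lip k * B₀ k * qT k) * |g k - g' k|) :=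
        add_le_add (h3 U) (h3 U₀)
    _ = Real.exp (-(κ * C.d X)) * ((2 * clip k * B₀ k + 2 * lip k * B₀ k * qT k) * |g k - g' k|) := by ring

/-- [folklore] **END #1 AT CONSTANT 1** — `NE9VacuumSubtractedBridge.ne9_and_fadingMemory_of_couplingTwoPoint_vacSub`'s binder list VERBATIM, `hpos` re-lettered ⊢ NE9
with the product moduli `ℓ = 2·clipbar·B + 2·lipbar·B·qTbar`, rate `ω + 2·lipbar·B·τ̄`, and `FadingMemory` of the same rate (END #1's: `8·clipbar·B + 8·lipbar·B·qTbar`,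
`ω + 8·lipbar·B·τ̄`); fed with `NE9TwoPointKPOfPencilSharp`'s `lipbar = 1/(R₀ − s₀)` this is the record floor `c_eff = 2` in END #1's own architecture. -/
theorem ne9_and_fadingMemory_of_couplingTwoPoint_vacSub_sharp1 [NormedSpace ℂ Pot] {ι : Type} {E : Functional C Bg}
    {W : Set (ℕ → ℝ)} {Adm : Set (Bg → C.Dom → ℝ)} {T : ℕ → (ℕ → ℝ) → (Bg → C.Dom → ℝ) → ι → ℝ}
    {Ψ : ℕ → ℝ → (ι → ℝ) → Bg → C.Dom → ℝ} {act : ℕ → ℝ → Bg → Pot → G.P → ℂ} {𝒜 : ℕ → Set Pot}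
    {n : ℕ → ℝ → Bg → G.P → ℝ} {lip clip : ℕ → ℝ} {a d : G.P → ℝ} {δ : C.Dom → ℝ}
    {κ B lipbar clipbar qTbar τbar ω : ℝ} {wt : ℕ → ι → ℝ} {τ : ℕ → ℕ → ℝ} {qT : ℕ → ℝ}
    (ρ : ℕ → (ι → ℝ) → Pot) (U₀ : Bg) (explZ : ℕ → Bg → C.Dom → ℝ) (h0 : ScaleZeroFree E W)
    (hAdm : AdmissibleTerms E W Adm) (hres : AdmRestrict Adm) (hadd : ChannelAdditive Adm T)
    (hsum : ChannelStepSum Adm T) (hstep : ChannelSizeAtStepNN Adm T κ wt τ) (hfac : Factorises E W T Ψ)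
    (hclip0 : ∀ k, 0 ≤ clip k)
    (hCup : ∀ g ∈ W, ∀ g' ∈ W, ∀ (k : ℕ) (U : Bg) (X : C.Dom), C.scale X = k + 1 → ∀ Q ∈ 𝒜 k, ∀ γ ∈ G.vol X,
      ‖act k (g k) U Q γ‖ ≤ n k (g' k) U γ ∧
        ‖act k (g k) U Q γ - act k (g' k) U Q γ‖ ≤ clip k * |g k - g' k| * n k (g' k) U γ)
    (hqT0 : ∀ k, 0 ≤ qT k)
    (hTcup : ∀ g ∈ W, ∀ g' ∈ W, ∀ (k : ℕ) (y : ι), |T k g (E g) y - T k g' (E g) y| ≤ wt k y * (qT k * |g k - g' k|))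
    (hreprV : ∀ (k : ℕ) (s : ℝ) (P : ι → ℝ) (U : Bg) (X : C.Dom),
      Ψ k s P U X = (G.newTerm act k s U X (ρ k P)).re - (G.newTerm act k s U₀ X (ρ k P)).re + explZ k U X)
    (hclipb : ∀ k, clip k ≤ clipbar) (hqTb : ∀ k, qT k ≤ qTbar)
    (hK : TwoPointKP G W act 𝒜 n lip a d) (hdec : G.DecayExtract δ d) (hpin : G.PinBudget a δ (fun _ => B) κ)
    (hρ : ∀ (k : ℕ) (P P' : ι → ℝ) (M : ℝ), (∀ y, |P y - P' y| ≤ wt k y * M) → ‖ρ k P - ρ k P'‖ ≤ M)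
    (hocc : ∀ g ∈ W, ∀ g' ∈ W, ∀ k : ℕ, ρ k (T k g' (E g)) ∈ 𝒜 k) (hB : 0 ≤ B)
    (hlipb : ∀ k, lip k ≤ lipbar) (hτbar : 0 ≤ τbar) (hω : 0 ≤ ω) (hpos : 0 < ω + 2 * lipbar * B * τbar)
    (hτ : ∀ k j, j ≤ k → 0 ≤ τ k j ∧ τ k j ≤ τbar * ω ^ (k - j)) :
    NE9 E W κ (prodModuli (2 * clipbar * B + 2 * lipbar * B * qTbar) fun _ => ω + 2 * lipbar * B * τbar) ∧
      FadingMemory ((2 * clipbar * B + 2 * lipbar * B * qTbar) / (ω + 2 * lipbar * B * τbar))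
        (ω + 2 * lipbar * B * τbar)
        (prodModuli (2 * clipbar * B + 2 * lipbar * B * qTbar) fun _ => ω + 2 * lipbar * B * τbar) := by
  have hlast := lastCouplingLipschitz_of_couplingTwoPoint_vacSub_sharp1 G ρ U₀ explZ hK hclip0 hCup hdec hpin hρ hreprV hqT0
    hTcup hocc
  have hout := outputLipschitz_of_twoPointKP_vacSub_sharp G ρ U₀ explZ hK hdec hpin hρ hreprV hocc
  have houter := outerLipschitz_of_factorisation hfac hlast hout
  have hlip0 : ∀ k, 0 ≤ lip k := hK.2.2.1
  have hclipbar : 0 ≤ clipbar := (hclip0 0).trans (hclipb 0)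
  have hlipbar : 0 ≤ lipbar := (hlip0 0).trans (hlipb 0)
  have hqTbar : 0 ≤ qTbar := (hqT0 0).trans (hqTb 0)
  have hℓ : 0 ≤ 2 * clipbar * B + 2 * lipbar * B * qTbar := by positivity
  have hc : 0 ≤ 2 * lipbar * B := by positivity
  have hlam : ∀ k, 2 * clip k * B + 2 * lip k * B * qT k ≤ 2 * clipbar * B + 2 * lipbar * B * qTbar := by
    intro k
    have h1 : 2 * clip k * B ≤ 2 * clipbar * B := by gcongr; exact hclipb k
    have h3 : 2 * lip k * B * qT k ≤ 2 * lipbar * B * qTbar := by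
      have := hlipb k; have := hqTb k; have := hlip0 k; have := hqT0 k
      gcongr
    linarith
  have hcΦ : ∀ k, 0 ≤ 2 * lip k * B ∧ 2 * lip k * B ≤ 2 * lipbar * B := fun k =>
    ⟨by have := hlip0 k; positivity, by gcongr; exact hlipb k⟩
  exact ne9_and_fadingMemory_of_perStepNN h0 hAdm hres hadd hsum hstep houter hℓ hc hτbar hω hpos hlam hcΦ hτ

/-- [folklore] **END #1 AT CONSTANT 1 WITH THE OCCUPATION DERIVED** — `NE9BridgeSizeInduction.ne9_and_fadingMemory_of_couplingTwoPoint_vacSub_sizeInduction`'s binder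
list VERBATIM, `hpos` re-lettered (the occupation from `termSize_of_recursion_vacSub` BY NAME) ⊢ `TermSize E W κ N ∧ NE9 … ∧ FadingMemory …` at
`(2·clipbar·B + 2·lipbar·B·qTbar, ω + 2·lipbar·B·τ̄)`. -/
theorem ne9_and_fadingMemory_of_couplingTwoPoint_vacSub_sizeInduction_sharp1 [NormedSpace ℂ Pot] {ι : Type}
    {E : Functional C Bg} {W : Set (ℕ → ℝ)} {Adm : Set (Bg → C.Dom → ℝ)} {T : ℕ → (ℕ → ℝ) → (Bg → C.Dom → ℝ) → ι → ℝ}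
    {Ψ : ℕ → ℝ → (ι → ℝ) → Bg → C.Dom → ℝ} {act : ℕ → ℝ → Bg → Pot → G.P → ℂ} {𝒜 : ℕ → Set Pot}
    {n : ℕ → ℝ → Bg → G.P → ℝ} {lip clip : ℕ → ℝ} {a d : G.P → ℝ} {δ : C.Dom → ℝ}
    {κ B lipbar clipbar qTbar τbar ω : ℝ} {wt : ℕ → ι → ℝ} {τ : ℕ → ℕ → ℝ} {qT p₀ N : ℕ → ℝ}
    (ρ : ℕ → (ι → ℝ) → Pot) (U₀ : Bg) (explZ : ℕ → Bg → C.Dom → ℝ) (h0 : ScaleZeroFree E W)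
    (hAdm : AdmissibleTerms E W Adm) (hres : AdmRestrict Adm) (hadd : ChannelAdditive Adm T)
    (hsum : ChannelStepSum Adm T) (hstep : ChannelSizeAtStepNN Adm T κ wt τ) (hfac : Factorises E W T Ψ)
    (hclip0 : ∀ k, 0 ≤ clip k)
    (hCup : ∀ g ∈ W, ∀ g' ∈ W, ∀ (k : ℕ) (U : Bg) (X : C.Dom), C.scale X = k + 1 → ∀ Q ∈ 𝒜 k, ∀ γ ∈ G.vol X,
      ‖act k (g k) U Q γ‖ ≤ n k (g' k) U γ ∧
        ‖act k (g k) U Q γ - act k (g' k) U Q γ‖ ≤ clip k * |g k - g' k| * n k (g' k) U γ)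
    (hqT0 : ∀ k, 0 ≤ qT k)
    (hTcup : ∀ g ∈ W, ∀ g' ∈ W, ∀ (k : ℕ) (y : ι), |T k g (E g) y - T k g' (E g) y| ≤ wt k y * (qT k * |g k - g' k|))
    (hreprV : ∀ (k : ℕ) (s : ℝ) (P : ι → ℝ) (U : Bg) (X : C.Dom),
      Ψ k s P U X = (G.newTerm act k s U X (ρ k P)).re - (G.newTerm act k s U₀ X (ρ k P)).re + explZ k U X)
    (hclipb : ∀ k, clip k ≤ clipbar) (hqTb : ∀ k, qT k ≤ qTbar)
    (hK : TwoPointKP G W act 𝒜 n lip a d) (hdec : G.DecayExtract δ d) (hpin : G.PinBudget a δ (fun _ => B) κ)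
    (hρ : ∀ (k : ℕ) (P P' : ι → ℝ) (M : ℝ), (∀ y, |P y - P' y| ≤ wt k y * M) → ‖ρ k P - ρ k P'‖ ≤ M)
    (hexplZ : ∀ (k : ℕ) (U : Bg) (X : C.Dom), C.scale X = k + 1 → |explZ k U X| ≤ Real.exp (-(κ * C.d X)) * p₀ k)
    (hbase : ∀ g ∈ W, ∀ (U : Bg) (X : C.Dom), C.scale X = 0 → |E g U X| ≤ Real.exp (-(κ * C.d X)) * N 0)
    (hNsucc : ∀ j, p₀ j + 2 * B ≤ N (j + 1)) (hNnn : ∀ j, 0 ≤ N j)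
    (hbox : ∀ (k : ℕ) (P : ι → ℝ), (∀ y, |P y| ≤ wt k y * sizeRadius τ N k) → ρ k P ∈ 𝒜 k)
    (hB : 0 ≤ B) (hlipb : ∀ k, lip k ≤ lipbar) (hτbar : 0 ≤ τbar) (hω : 0 ≤ ω) (hpos : 0 < ω + 2 * lipbar * B * τbar)
    (hτ : ∀ k j, j ≤ k → 0 ≤ τ k j ∧ τ k j ≤ τbar * ω ^ (k - j)) :
    TermSize E W κ N ∧
      NE9 E W κ (prodModuli (2 * clipbar * B + 2 * lipbar * B * qTbar) fun _ => ω + 2 * lipbar * B * τbar) ∧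
        FadingMemory ((2 * clipbar * B + 2 * lipbar * B * qTbar) / (ω + 2 * lipbar * B * τbar))
          (ω + 2 * lipbar * B * τbar)
          (prodModuli (2 * clipbar * B + 2 * lipbar * B * qTbar) fun _ => ω + 2 * lipbar * B * τbar) := by
  obtain ⟨hT, hocc⟩ := termSize_of_recursion_vacSub G ρ U₀ explZ hAdm (channelSizeNN_of_perStepNN hres hsum hstep) hfac hK
    hdec hpin hreprV hexplZ hbase hNsucc hNnn hbox
  exact ⟨hT, ne9_and_fadingMemory_of_couplingTwoPoint_vacSub_sharp1 G ρ U₀ explZ h0 hAdm hres hadd hsum hstep hfac hclip0 hCup hqT0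
    hTcup hreprV hclipb hqTb hK hdec hpin hρ hocc hB hlipb hτbar hω hpos hτ⟩

end End

/-! ## §2 The (L) lemma of `NE9VacuumSubtractedBridgeSharp` (stadium table half) with the coupling part at constant 1 — the drop-in for E131 §3 -/

section StadiumTable

variable {C : Carriers} (G : ClusterGeom C) {Bg : Type} {Pot : Type*} [NormedAddCommGroup Pot] [NormedSpace ℂ Pot]

/-- [folklore] **`LastCouplingLipschitz` WITH THE VACUUM SUBTRACTION, BOTH HALVES AT CONSTANT 1** — the sibling of this lineage's
`NE9VacuumSubtractedBridgeSharp.lastCouplingLipschitz_of_couplingTwoPoint_vacSub_sharp` (p256991 §1, consumed by the owner's E131 `NE9HoloFamilyCoupledEnd` §3) with the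
COUPLING part on `NE9MajorantLipschitzSharp.norm_newTerm_sub_le_of_couplingTwoPoint_sharp` (constant `clip`, was `4·clip`) and the configuration part on the owner's stadium bound; SAME binders:
COUPLING TWO-POINT (`hCup`, with `TwoPointKP`'s majorant `n` on `𝒜 k`; constant `4·clip` per background, unchanged) ∧ CHANNEL COUPLING MODULUS
(`hTcup`) ∧ the pencil binder `PotentialKPG` ∧ room ∧ `𝒜 k ⊆ closedBall 0 s₀` ∧ decay ∧ pin budget ∧ reading law ∧ occupation ∧ `hreprV` ⇒
`LastCouplingLipschitz E W T Ψ κ (fun k ↦ 2·clip k·B₀ k + 2·B₀ k/(R₀ − s₀)·qT k)` (p256991 §1: `8·clip k·B₀ k + …`; E131's ℓ coupling part thereby `÷ 4` by one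
lemma-name swap, owner's option).  The coupling-free part `explZ` CANCELS. -/
theorem lastCouplingLipschitz_of_couplingTwoPoint_vacSub_sharp2 {ι : Type} {E : Functional C Bg} {W : Set (ℕ → ℝ)}
    {T : ℕ → (ℕ → ℝ) → (Bg → C.Dom → ℝ) → ι → ℝ} {Ψ : ℕ → ℝ → (ι → ℝ) → Bg → C.Dom → ℝ}
    {act : ℕ → ℝ → Bg → Pot → G.P → ℂ} {𝒜 : ℕ → Set Pot} {n m : ℕ → ℝ → Bg → G.P → ℝ} {lip clip : ℕ → ℝ}
    {a d : G.P → ℝ} {δ : C.Dom → ℝ} {B₀ qT : ℕ → ℝ} {κ s₀ R₀ : ℝ} {wt : ℕ → ι → ℝ} (ρ : ℕ → (ι → ℝ) → Pot) (U₀ : Bg)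
    (explZ : ℕ → Bg → C.Dom → ℝ) (hK : TwoPointKP G W act 𝒜 n lip a d) (hKP : G.PotentialKPG W act m a d R₀)
    (hsR : s₀ < R₀) (h𝒜 : ∀ k, 𝒜 k ⊆ closedBall (0 : Pot) s₀) (hclip0 : ∀ k, 0 ≤ clip k)
    (hCup : ∀ g ∈ W, ∀ g' ∈ W, ∀ (k : ℕ) (U : Bg) (X : C.Dom), C.scale X = k + 1 → ∀ Q ∈ 𝒜 k, ∀ γ ∈ G.vol X,
      ‖act k (g k) U Q γ‖ ≤ n k (g' k) U γ ∧
        ‖act k (g k) U Q γ - act k (g' k) U Q γ‖ ≤ clip k * |g k - g' k| * n k (g' k) U γ)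
    (hdec : G.DecayExtract δ d) (hpin : G.PinBudget a δ B₀ κ)
    (hρ : ∀ (k : ℕ) (P P' : ι → ℝ) (M : ℝ), (∀ y, |P y - P' y| ≤ wt k y * M) → ‖ρ k P - ρ k P'‖ ≤ M)
    (hreprV : ∀ (k : ℕ) (s : ℝ) (P : ι → ℝ) (U : Bg) (X : C.Dom),
      Ψ k s P U X = (G.newTerm act k s U X (ρ k P)).re - (G.newTerm act k s U₀ X (ρ k P)).re + explZ k U X)
    (hqT0 : ∀ k, 0 ≤ qT k)
    (hTcup : ∀ g ∈ W, ∀ g' ∈ W, ∀ (k : ℕ) (y : ι), |T k g (E g) y - T k g' (E g) y| ≤ wt k y * (qT k * |g k - g' k|))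
    (hocc : ∀ g ∈ W, ∀ g' ∈ W, ∀ k : ℕ, ρ k (T k g' (E g)) ∈ 𝒜 k) :
    LastCouplingLipschitz E W T Ψ κ (fun k => 2 * clip k * B₀ k + 2 * B₀ k / (R₀ - s₀) * qT k) := by
  obtain ⟨ha, hd, hP⟩ := hKP
  intro g hg g' hg' k U X hX
  set P : ι → ℝ := T k g (E g)
  set P' : ι → ℝ := T k g' (E g)
  have hQ : ρ k P ∈ 𝒜 k := hocc g hg g hg k
  have hQ' : ρ k P' ∈ 𝒜 k := hocc g hg g' hg' k
  have hQn : ‖ρ k P‖ ≤ s₀ := mem_closedBall_zero_iff.1 (h𝒜 k hQ)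
  have hQ'n : ‖ρ k P'‖ ≤ s₀ := mem_closedBall_zero_iff.1 (h𝒜 k hQ')
  have ha0 : 0 ≤ a (G.pin X) := ha _
  have hclip0k : 0 ≤ clip k := hclip0 k
  have hqT0k : 0 ≤ qT k := hqT0 k
  have hϱ : 0 < R₀ - s₀ := sub_pos.mpr hsR
  have henv := hpin k X hX
  have hΔ : 0 ≤ |g k - g' k| := abs_nonneg _
  -- (i) same configuration, two couplings, at any background V (the coupling two-point AT CONSTANT 1)
  have h1 : ∀ V : Bg, ‖G.newTerm act k (g k) V X (ρ k P) - G.newTerm act k (g' k) V X (ρ k P)‖ ≤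
      Real.exp (-(κ * C.d X)) * (clip k * B₀ k * |g k - g' k|) := by
    intro V
    have hnt := norm_newTerm_sub_le_of_couplingTwoPoint_sharp G hK hclip0 hCup hdec hg hg' hX (U := V) hQ
    calc ‖G.newTerm act k (g k) V X (ρ k P) - G.newTerm act k (g' k) V X (ρ k P)‖
        ≤ (clip k * |g k - g' k|) * a (G.pin X) * Real.exp (-(δ X)) := hnt
      _ = clip k * |g k - g' k| * (a (G.pin X) * Real.exp (-(δ X))) := by ring
      _ ≤ clip k * |g k - g' k| * (B₀ k * Real.exp (-(κ * C.d X))) :=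
          mul_le_mul_of_nonneg_left henv (by positivity)
      _ = Real.exp (-(κ * C.d X)) * (clip k * B₀ k * |g k - g' k|) := by ring
  -- (ii) same coupling g′ k, two occurring configurations, at any background V — THE STADIUM BOUND (constant 1)
  have hdist : ‖ρ k P - ρ k P'‖ ≤ qT k * |g k - g' k| :=
    hρ k P P' (qT k * |g k - g' k|) fun y => hTcup g hg g' hg' k y
  have h2 : ∀ V : Bg, ‖G.newTerm act k (g' k) V X (ρ k P) - G.newTerm act k (g' k) V X (ρ k P')‖ ≤
      Real.exp (-(κ * C.d X)) * (B₀ k / (R₀ - s₀) * qT k * |g k - g' k|) := by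
    intro V
    obtain ⟨hhol, hmaj, hkp⟩ := hP g' hg' k V X hX
    have hnt := norm_clusterSum_sub_le_of_ballKPG_sharp (inc := G.inc) (w := fun Q => act k (g' k) V Q) ha hd hsR hhol hmaj
      hkp (G.pin_mem X) (G.clus_sub X) (G.clus_pin X) (hdec X) hQn hQ'n
    have hB0 : 0 ≤ (B₀ k * Real.exp (-(κ * C.d X))) / (R₀ - s₀) :=
      div_nonneg ((mul_nonneg ha0 (Real.exp_nonneg _)).trans henv) hϱ.le
    calc ‖G.newTerm act k (g' k) V X (ρ k P) - G.newTerm act k (g' k) V X (ρ k P')‖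
        ≤ (a (G.pin X) * Real.exp (-(δ X))) / (R₀ - s₀) * ‖ρ k P - ρ k P'‖ := hnt
      _ ≤ (B₀ k * Real.exp (-(κ * C.d X))) / (R₀ - s₀) * (qT k * |g k - g' k|) :=
          mul_le_mul (div_le_div_of_nonneg_right henv hϱ.le) hdist (norm_nonneg _) hB0
      _ = Real.exp (-(κ * C.d X)) * (B₀ k / (R₀ - s₀) * qT k * |g k - g' k|) := by ring
  -- combine: at U and at U₀, couplings then configurations
  have h3 : ∀ V : Bg, ‖G.newTerm act k (g k) V X (ρ k P) - G.newTerm act k (g' k) V X (ρ k P')‖ ≤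
      Real.exp (-(κ * C.d X)) * ((clip k * B₀ k + B₀ k / (R₀ - s₀) * qT k) * |g k - g' k|) := by
    intro V
    calc ‖G.newTerm act k (g k) V X (ρ k P) - G.newTerm act k (g' k) V X (ρ k P')‖
        ≤ ‖G.newTerm act k (g k) V X (ρ k P) - G.newTerm act k (g' k) V X (ρ k P)‖ +
            ‖G.newTerm act k (g' k) V X (ρ k P) - G.newTerm act k (g' k) V X (ρ k P')‖ := norm_sub_le_norm_sub_add_norm_sub _ _ _
      _ ≤ Real.exp (-(κ * C.d X)) * (clip k * B₀ k * |g k - g' k|) +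
            Real.exp (-(κ * C.d X)) * (B₀ k / (R₀ - s₀) * qT k * |g k - g' k|) := add_le_add (h1 V) (h2 V)
      _ = Real.exp (-(κ * C.d X)) * ((clip k * B₀ k + B₀ k / (R₀ - s₀) * qT k) * |g k - g' k|) := by ring
  rw [hreprV k (g k) P U X, hreprV k (g' k) P' U X]
  calc |(G.newTerm act k (g k) U X (ρ k P)).re - (G.newTerm act k (g k) U₀ X (ρ k P)).re + explZ k U X -
          ((G.newTerm act k (g' k) U X (ρ k P')).re - (G.newTerm act k (g' k) U₀ X (ρ k P')).re + explZ k U X)|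
      = |(G.newTerm act k (g k) U X (ρ k P) - G.newTerm act k (g' k) U X (ρ k P')).re -
          (G.newTerm act k (g k) U₀ X (ρ k P) - G.newTerm act k (g' k) U₀ X (ρ k P')).re| := by
        rw [Complex.sub_re, Complex.sub_re]; ring_nf
    _ ≤ ‖G.newTerm act k (g k) U X (ρ k P) - G.newTerm act k (g' k) U X (ρ k P')‖ +
          ‖G.newTerm act k (g k) U₀ X (ρ k P) - G.newTerm act k (g' k) U₀ X (ρ k P')‖ := abs_re_sub_re_le _ _
    _ ≤ Real.exp (-(κ * C.d X)) * ((clip k * B₀ k + B₀ k / (R₀ - s₀) * qT k) * |g k - g' k|) +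
          Real.exp (-(κ * C.d X)) * ((clip k * B₀ k + B₀ k / (R₀ - s₀) * qT k) * |g k - g' k|) :=
        add_le_add (h3 U) (h3 U₀)
    _ = Real.exp (-(κ * C.d X)) * ((2 * clip k * B₀ k + 2 * B₀ k / (R₀ - s₀) * qT k) * |g k - g' k|) := by ring


end StadiumTable

end Summit.QuantumFields.BalabanUV.T4Continuum.NE9VacuumSubtractedBridgeFloor

end
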